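import Mathlib.Analysis.Convex.Mul
import Mathlib.Tactic

/-!
# Affine parameter enclosures for the torus joint-LMI model over the certified `(a,h)`-box

Route `FreeSplittingCertificates`, crux `StrictSplittingRule` (stmt-AtomisticToContinuum-12560), unit b2b-freesplit-B
(block 2b, PART B, gen 3).  VALUE = certificate infrastructure for a FINITE model — not summit progress.

The stub `stub_coreJointCoercive` speaks about the EXACT hcp-family minimiser `(a*, h*)`, which the tree localises to
the box `|a − 97129/10⁵| ≤ 10⁻⁴`, `|h − 39647/(5·10⁴)| ≤ 10⁻⁴` (`hcpFamilyMin_enclosure`).  Transporting the rational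
torus certificates (…TorusModel442A/B, …TorusModel663A/B) to every point of that box needs FIRST-ORDER control of
the model's coefficients in `(a,h)` (a zero-order interval transport loses ≈ 0.05 > the 4×4×2 margin 0.0426, CERT.md §12):
every coefficient is a product of a lattice monomial in `(a,h)` and an LJ weight `W′(s) = ½(s⁻⁴ − s⁻⁷)` or
`W″(s) = ½(7s⁻⁸ − 4s⁻⁵)` at a squared bond length `s = σa² + τh²`.  This file provides the bookkeeping:
`AffEncl a₀ h₀ Δ f c₀ c₁ c₂ ρ` (on the box, `f` is within `ρ` of the affine function `c₀ + c₁(a−a₀) + c₂(h−h₀)`),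
closed under `+`, scalar multiples and PRODUCTS (`AffEncl.mul`, second-order remainder explicit), the exact enclosure of
`σa² + τh²` (`AffEncl.sqLen`), and the two elementary inequalities that enclose `s⁻ⁿ` between its TANGENT at the centre
(`inv_pow_tangent_le`, Bernoulli — no calculus) and its CHORD (`inv_pow_le_chord`, `convexOn_zpow`), assembled into
`AffEncl.invPow_sqLen` whose side conditions are decidable rational inequalities (`norm_num`; see the closing
`example`: radius `2.5·10⁻⁶` for `s⁻⁸` at the first shell, i.e. second order in the box width), plus the two reduction
steps of a box certificate: `AffEncl.sum_mul_ge` (a parametrised form `Σ_k t_k(a,h)·P_k(v)` is bounded below by an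
affine-in-`(a,h)` family minus the fixed majorant `Σ_k ρ_k|P_k(v)|`) and `AffEncl.corners_nonneg` (an affine family is
nonnegative on the box iff at its four corners — four rational matrix certificates).  How the pieces are meant to be
assembled (parametrised 4×4×2 model, `S`-procedure lift of the least-squares rotation to 195 variables, β as boxed data),
and the exact-arithmetic box certificate they mirror (kit j055609–j055626), are recorded in the cell's CERT.md §12–§13.
Nothing here is specific to one torus size.  [folklore]
-/

namespace Summit.AtomisticToContinuum.Crystallization.Theorems.StrictSplittingRuleTorusLMI

/-! ## The two scalar inequalities for `s ↦ s⁻ⁿ` -/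

/-- **Tangent inequality** for the convex function `s ↦ s⁻ⁿ` on `(0,∞)`, proved from Bernoulli's inequality:
`m⁻ⁿ − n·m⁻ⁿ⁻¹(s − m) ≤ s⁻ⁿ` for `0 < m`, `0 < s`. [folklore] -/
theorem inv_pow_tangent_le (n : ℕ) {m s : ℝ} (hm : 0 < m) (hs : 0 < s) :
    m⁻¹ ^ n - n * m⁻¹ ^ (n + 1) * (s - m) ≤ s⁻¹ ^ n := by
  have hy : -2 ≤ (m - s) / s := by
    rw [le_div_iff₀ hs]; nlinarith
  have hB := one_add_mul_le_pow hy n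
  have h1 : (1 + (m - s) / s) = m / s := by field_simp; ring
  rw [h1, div_pow] at hB
  have key : s⁻¹ ^ n = m⁻¹ ^ n * (m ^ n / s ^ n) := by
    rw [inv_pow, inv_pow]; field_simp
  rw [key]
  have hmn : 0 < m⁻¹ ^ n := by positivity
  have step : m⁻¹ ^ n - n * m⁻¹ ^ (n + 1) * (s - m) = m⁻¹ ^ n * (1 + n * ((m - s) / m)) := by
    rw [pow_succ]; field_simp; ring
  rw [step]
  apply mul_le_mul_of_nonneg_left _ hmn.le
  calc 1 + (n : ℝ) * ((m - s) / m) ≤ 1 + n * ((m - s) / s) := by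
        have hle : (m - s) / m ≤ (m - s) / s := by
          rw [div_le_div_iff₀ hm hs]; nlinarith [sq_nonneg (m - s)]
        have hn : (0 : ℝ) ≤ n := n.cast_nonneg
        nlinarith
    _ ≤ m ^ n / s ^ n := hB

/-- **Chord inequality** for the convex function `s ↦ s⁻ⁿ` (`Mathlib.convexOn_zpow`): on `[lo, hi] ⊂ (0,∞)`,
`s⁻ⁿ ≤ lo⁻ⁿ + (hi⁻ⁿ − lo⁻ⁿ)/(hi − lo)·(s − lo)`. [folklore] -/
theorem inv_pow_le_chord (n : ℕ) {lo hi s : ℝ} (hlo : 0 < lo) (hlh : lo < hi) (h1 : lo ≤ s) (h2 : s ≤ hi) :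
    s⁻¹ ^ n ≤ lo⁻¹ ^ n + (hi⁻¹ ^ n - lo⁻¹ ^ n) / (hi - lo) * (s - lo) := by
  have hcv := (convexOn_zpow (𝕜 := ℝ) (-(n : ℤ)))
  set t := (s - lo) / (hi - lo) with ht
  have hhl : 0 < hi - lo := by linarith
  have ht0 : 0 ≤ t := div_nonneg (by linarith) hhl.le
  have hs_eq : (1 - t) * lo + t * hi = s := by rw [ht]; field_simp; ring
  have hc := hcv.2 (Set.mem_Ioi.2 hlo) (Set.mem_Ioi.2 (hlo.trans hlh)) (by
      show (0 : ℝ) ≤ 1 - t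
      rw [ht, sub_nonneg, div_le_one hhl]; linarith) ht0 (by ring : (1 - t) + t = 1)
  simp only [smul_eq_mul] at hc
  have conv : ∀ x : ℝ, 0 < x → x ^ (-(n : ℤ)) = x⁻¹ ^ n := by
    intro x hx; rw [zpow_neg, zpow_natCast, inv_pow]
  rw [hs_eq, conv s (by linarith), conv lo hlo, conv hi (by linarith)] at hc
  have hr : lo⁻¹ ^ n + (hi⁻¹ ^ n - lo⁻¹ ^ n) / (hi - lo) * (s - lo) = (1 - t) * lo⁻¹ ^ n + t * hi⁻¹ ^ n := by
    rw [ht]; field_simp; ring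
  linarith [hc, hr]

/-! ## Affine enclosures on the `(a,h)`-box -/

/-- `AffEncl a₀ h₀ Δ f c₀ c₁ c₂ ρ`: for all `(a,h)` with `|a − a₀| ≤ Δ`, `|h − h₀| ≤ Δ`,
`|f a h − (c₀ + c₁(a − a₀) + c₂(h − h₀))| ≤ ρ`. [folklore] -/
def AffEncl (a₀ h₀ Δ : ℝ) (f : ℝ → ℝ → ℝ) (c₀ c₁ c₂ ρ : ℝ) : Prop :=
  ∀ a h : ℝ, |a - a₀| ≤ Δ → |h - h₀| ≤ Δ → |f a h - (c₀ + c₁ * (a - a₀) + c₂ * (h - h₀))| ≤ ρ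

namespace AffEncl

variable {a₀ h₀ Δ : ℝ}

/-- Constants are enclosed exactly. [folklore] -/
theorem const (c : ℝ) : AffEncl a₀ h₀ Δ (fun _ _ => c) c 0 0 0 := by
  intro a h _ _; simp

/-- The first coordinate `a`. [folklore] -/
theorem fst : AffEncl a₀ h₀ Δ (fun a _ => a) a₀ 1 0 0 := by
  intro a h _ _; simp

/-- The second coordinate `h`. [folklore] -/
theorem snd : AffEncl a₀ h₀ Δ (fun _ h => h) h₀ 0 1 0 := by
  intro a h _ _; simp

/-- Weakening of the radius. [folklore] -/
theorem weaken {f : ℝ → ℝ → ℝ} {c₀ c₁ c₂ ρ ρ' : ℝ} (hf : AffEncl a₀ h₀ Δ f c₀ c₁ c₂ ρ) (hρ : ρ ≤ ρ') :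
    AffEncl a₀ h₀ Δ f c₀ c₁ c₂ ρ' :=
  fun a h ha hh => (hf a h ha hh).trans hρ

/-- Sums. [folklore] -/
theorem add {f g : ℝ → ℝ → ℝ} {c₀ c₁ c₂ ρ d₀ d₁ d₂ σ : ℝ}
    (hf : AffEncl a₀ h₀ Δ f c₀ c₁ c₂ ρ) (hg : AffEncl a₀ h₀ Δ g d₀ d₁ d₂ σ) :
    AffEncl a₀ h₀ Δ (fun a h => f a h + g a h) (c₀ + d₀) (c₁ + d₁) (c₂ + d₂) (ρ + σ) := by
  intro a h ha hh
  have h1 := hf a h ha hh; have h2 := hg a h ha hh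
  calc |f a h + g a h - (c₀ + d₀ + (c₁ + d₁) * (a - a₀) + (c₂ + d₂) * (h - h₀))|
      = |(f a h - (c₀ + c₁ * (a - a₀) + c₂ * (h - h₀))) + (g a h - (d₀ + d₁ * (a - a₀) + d₂ * (h - h₀)))| := by
        ring_nf
    _ ≤ _ := abs_add_le _ _
    _ ≤ ρ + σ := add_le_add h1 h2

/-- Scalar multiples. [folklore] -/
theorem smul (k : ℝ) {f : ℝ → ℝ → ℝ} {c₀ c₁ c₂ ρ : ℝ} (hf : AffEncl a₀ h₀ Δ f c₀ c₁ c₂ ρ) :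
    AffEncl a₀ h₀ Δ (fun a h => k * f a h) (k * c₀) (k * c₁) (k * c₂) (|k| * ρ) := by
  intro a h ha hh
  have h1 := hf a h ha hh
  calc |k * f a h - (k * c₀ + k * c₁ * (a - a₀) + k * c₂ * (h - h₀))|
      = |k * (f a h - (c₀ + c₁ * (a - a₀) + c₂ * (h - h₀)))| := by ring_nf
    _ = |k| * |f a h - (c₀ + c₁ * (a - a₀) + c₂ * (h - h₀))| := abs_mul _ _
    _ ≤ |k| * ρ := mul_le_mul_of_nonneg_left h1 (abs_nonneg k)

/-- Differences. [folklore] -/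
theorem sub {f g : ℝ → ℝ → ℝ} {c₀ c₁ c₂ ρ d₀ d₁ d₂ σ : ℝ}
    (hf : AffEncl a₀ h₀ Δ f c₀ c₁ c₂ ρ) (hg : AffEncl a₀ h₀ Δ g d₀ d₁ d₂ σ) :
    AffEncl a₀ h₀ Δ (fun a h => f a h - g a h) (c₀ - d₀) (c₁ - d₁) (c₂ - d₂) (ρ + σ) := by
  have h := add hf (smul (-1) hg)
  simp only [abs_neg, abs_one, one_mul, neg_one_mul] at h
  intro a h' ha hh
  have := h a h' ha hh
  simp only [sub_eq_add_neg]
  convert this using 2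
  ring

/-- **Products** (the second-order remainder made explicit). [folklore] -/
theorem mul (hΔ : 0 ≤ Δ) {f g : ℝ → ℝ → ℝ} {c₀ c₁ c₂ ρ d₀ d₁ d₂ σ : ℝ}
    (hf : AffEncl a₀ h₀ Δ f c₀ c₁ c₂ ρ) (hg : AffEncl a₀ h₀ Δ g d₀ d₁ d₂ σ) :
    AffEncl a₀ h₀ Δ (fun a h => f a h * g a h) (c₀ * d₀) (c₀ * d₁ + c₁ * d₀) (c₀ * d₂ + c₂ * d₀)
      ((|c₁| + |c₂|) * (|d₁| + |d₂|) * Δ ^ 2 + ρ * (|d₀| + (|d₁| + |d₂|) * Δ) +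
        σ * (|c₀| + (|c₁| + |c₂|) * Δ) + ρ * σ) := by
  intro a h ha hh
  have hρ : 0 ≤ ρ := (abs_nonneg _).trans (hf a₀ h₀ (by simp [hΔ]) (by simp [hΔ]))
  have hσ : 0 ≤ σ := (abs_nonneg _).trans (hg a₀ h₀ (by simp [hΔ]) (by simp [hΔ]))
  set x := a - a₀ with hx
  set y := h - h₀ with hy
  set P := c₁ * x + c₂ * y with hP
  set Q := d₁ * x + d₂ * y with hQ
  set ef := f a h - (c₀ + c₁ * x + c₂ * y) with hef
  set eg := g a h - (d₀ + d₁ * x + d₂ * y) with heg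
  have h1 : |ef| ≤ ρ := hf a h ha hh
  have h2 : |eg| ≤ σ := hg a h ha hh
  have hPb : |P| ≤ (|c₁| + |c₂|) * Δ := by
    calc |P| ≤ |c₁ * x| + |c₂ * y| := abs_add_le _ _
      _ = |c₁| * |x| + |c₂| * |y| := by rw [abs_mul, abs_mul]
      _ ≤ |c₁| * Δ + |c₂| * Δ := add_le_add (mul_le_mul_of_nonneg_left ha (abs_nonneg _))
          (mul_le_mul_of_nonneg_left hh (abs_nonneg _))
      _ = (|c₁| + |c₂|) * Δ := by ring
  have hQb : |Q| ≤ (|d₁| + |d₂|) * Δ := by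
    calc |Q| ≤ |d₁ * x| + |d₂ * y| := abs_add_le _ _
      _ = |d₁| * |x| + |d₂| * |y| := by rw [abs_mul, abs_mul]
      _ ≤ |d₁| * Δ + |d₂| * Δ := add_le_add (mul_le_mul_of_nonneg_left ha (abs_nonneg _))
          (mul_le_mul_of_nonneg_left hh (abs_nonneg _))
      _ = (|d₁| + |d₂|) * Δ := by ring
  have hrem : f a h * g a h - (c₀ * d₀ + (c₀ * d₁ + c₁ * d₀) * x + (c₀ * d₂ + c₂ * d₀) * y) =
      P * Q + ef * (d₀ + Q) + eg * (c₀ + P) + ef * eg := by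
    rw [hef, heg, hP, hQ]; ring
  rw [hrem]
  have t1 : |P * Q| ≤ (|c₁| + |c₂|) * (|d₁| + |d₂|) * Δ ^ 2 := by
    rw [abs_mul]
    calc |P| * |Q| ≤ (|c₁| + |c₂|) * Δ * ((|d₁| + |d₂|) * Δ) :=
          mul_le_mul hPb hQb (abs_nonneg _) (by positivity)
      _ = _ := by ring
  have t2 : |ef * (d₀ + Q)| ≤ ρ * (|d₀| + (|d₁| + |d₂|) * Δ) := by
    rw [abs_mul]
    exact mul_le_mul h1 ((abs_add_le _ _).trans (add_le_add le_rfl hQb)) (abs_nonneg _) hρ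
  have t3 : |eg * (c₀ + P)| ≤ σ * (|c₀| + (|c₁| + |c₂|) * Δ) := by
    rw [abs_mul]
    exact mul_le_mul h2 ((abs_add_le _ _).trans (add_le_add le_rfl hPb)) (abs_nonneg _) hσ
  have t4 : |ef * eg| ≤ ρ * σ := by
    rw [abs_mul]; exact mul_le_mul h1 h2 (abs_nonneg _) hρ
  calc |P * Q + ef * (d₀ + Q) + eg * (c₀ + P) + ef * eg|
      ≤ |P * Q + ef * (d₀ + Q) + eg * (c₀ + P)| + |ef * eg| := abs_add_le _ _
    _ ≤ |P * Q + ef * (d₀ + Q)| + |eg * (c₀ + P)| + |ef * eg| := by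
        gcongr; exact abs_add_le _ _
    _ ≤ |P * Q| + |ef * (d₀ + Q)| + |eg * (c₀ + P)| + |ef * eg| := by
        gcongr; exact abs_add_le _ _
    _ ≤ _ := by linarith

/-- **Squared bond lengths** `s(a,h) = σa² + τh²` (`σ, τ ≥ 0`): exact enclosure with one-sided remainder
`σ(a−a₀)² + τ(h−h₀)² ∈ [0, (σ+τ)Δ²]`, recorded as a symmetric radius `(σ+τ)Δ²` about the tangent plane. [folklore] -/
theorem sqLen {σ τ : ℝ} (hσ : 0 ≤ σ) (hτ : 0 ≤ τ) :
    AffEncl a₀ h₀ Δ (fun a h => σ * a ^ 2 + τ * h ^ 2) (σ * a₀ ^ 2 + τ * h₀ ^ 2) (2 * σ * a₀) (2 * τ * h₀)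
      ((σ + τ) * Δ ^ 2) := by
  intro a h ha hh
  have hΔ : 0 ≤ Δ := (abs_nonneg _).trans ha
  have hx : (a - a₀) ^ 2 ≤ Δ ^ 2 := by
    rw [← sq_abs (a - a₀)]; exact pow_le_pow_left₀ (abs_nonneg _) ha 2
  have hy : (h - h₀) ^ 2 ≤ Δ ^ 2 := by
    rw [← sq_abs (h - h₀)]; exact pow_le_pow_left₀ (abs_nonneg _) hh 2
  have hrem : σ * a ^ 2 + τ * h ^ 2 - (σ * a₀ ^ 2 + τ * h₀ ^ 2 + 2 * σ * a₀ * (a - a₀) + 2 * τ * h₀ * (h - h₀)) =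
      σ * (a - a₀) ^ 2 + τ * (h - h₀) ^ 2 := by ring
  rw [hrem, abs_of_nonneg (by positivity)]
  calc σ * (a - a₀) ^ 2 + τ * (h - h₀) ^ 2 ≤ σ * Δ ^ 2 + τ * Δ ^ 2 :=
        add_le_add (mul_le_mul_of_nonneg_left hx hσ) (mul_le_mul_of_nonneg_left hy hτ)
    _ = (σ + τ) * Δ ^ 2 := by ring

/-- An affine function of `w` on `|w| ≤ B` is at most its value at `0` plus `|slope|·B`. [folklore] -/
theorem affine_le_of_abs_le {D₀ D₁ w B : ℝ} (hw : |w| ≤ B) : D₀ + D₁ * w ≤ D₀ + |D₁| * B := by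
  have : D₁ * w ≤ |D₁| * B := by
    calc D₁ * w ≤ |D₁ * w| := le_abs_self _
      _ = |D₁| * |w| := abs_mul _ _
      _ ≤ |D₁| * B := mul_le_mul_of_nonneg_left hw (abs_nonneg _)
  linarith

/-- **Inverse powers of a squared bond length**: on the box (with `Δ ≤ a₀`, `Δ ≤ h₀`), the function
`(a,h) ↦ (σa² + τh²)⁻ⁿ` lies within `ρ` of its tangent plane at the centre, `m⁻ⁿ − n m⁻ⁿ⁻¹·(2σa₀(a−a₀) + 2τh₀(h−h₀))`
(`m = σa₀² + τh₀²`), provided the decidable side conditions hold: `s` stays in `[lo, hi] ⊂ (0,∞)`, the tangent-side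
deficit `n m⁻ⁿ⁻¹(σ+τ)Δ²` and the chord-side excess `D₀ + |D₁|·GΔ` (chord of `s⁻ⁿ` over `[lo,hi]` minus the tangent line,
maximised over the strip) are `≤ ρ`.  Lower side: `inv_pow_tangent_le`; upper side: `inv_pow_le_chord`. [folklore] -/
theorem invPow_sqLen (n : ℕ) {σ τ lo hi ρ m κ G D₀ D₁ : ℝ} (hσ : 0 ≤ σ) (hτ : 0 ≤ τ)
    (ha₀ : Δ ≤ a₀) (hh₀ : Δ ≤ h₀) (hlo : 0 < lo) (hlh : lo < hi)
    (hlo' : lo ≤ σ * (a₀ - Δ) ^ 2 + τ * (h₀ - Δ) ^ 2) (hhi' : σ * (a₀ + Δ) ^ 2 + τ * (h₀ + Δ) ^ 2 ≤ hi)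
    (hm : m = σ * a₀ ^ 2 + τ * h₀ ^ 2) (hκ : κ = (hi⁻¹ ^ n - lo⁻¹ ^ n) / (hi - lo)) (hG : G = 2 * σ * a₀ + 2 * τ * h₀)
    (hD₀ : D₀ = lo⁻¹ ^ n + κ * (m - lo) - m⁻¹ ^ n) (hD₁ : D₁ = κ + n * m⁻¹ ^ (n + 1))
    (hρ₁ : n * m⁻¹ ^ (n + 1) * ((σ + τ) * Δ ^ 2) ≤ ρ) (hρ₂ : D₀ + |D₁| * (G * Δ) ≤ ρ) :
    AffEncl a₀ h₀ Δ (fun a h => (σ * a ^ 2 + τ * h ^ 2)⁻¹ ^ n) (m⁻¹ ^ n)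
      (-(n * m⁻¹ ^ (n + 1) * (2 * σ * a₀))) (-(n * m⁻¹ ^ (n + 1) * (2 * τ * h₀))) ρ := by
  intro a h ha hh
  have hΔ : 0 ≤ Δ := (abs_nonneg _).trans ha
  have ha' := abs_le.1 ha; have hh' := abs_le.1 hh
  have ha_nn : 0 ≤ a := by linarith
  have hh_nn : 0 ≤ h := by linarith
  set s := σ * a ^ 2 + τ * h ^ 2 with hs
  set w := 2 * σ * a₀ * (a - a₀) + 2 * τ * h₀ * (h - h₀) with hw
  set e := σ * (a - a₀) ^ 2 + τ * (h - h₀) ^ 2 with he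
  have hsdec : s = m + w + e := by rw [hs, hm, hw, he]; ring
  have he0 : 0 ≤ e := by positivity
  have heε : e ≤ (σ + τ) * Δ ^ 2 := by
    have hx : (a - a₀) ^ 2 ≤ Δ ^ 2 := by
      rw [← sq_abs (a - a₀)]; exact pow_le_pow_left₀ (abs_nonneg _) ha 2
    have hy : (h - h₀) ^ 2 ≤ Δ ^ 2 := by
      rw [← sq_abs (h - h₀)]; exact pow_le_pow_left₀ (abs_nonneg _) hh 2
    calc e ≤ σ * Δ ^ 2 + τ * Δ ^ 2 := add_le_add (mul_le_mul_of_nonneg_left hx hσ) (mul_le_mul_of_nonneg_left hy hτ)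
      _ = (σ + τ) * Δ ^ 2 := by ring
  have h2σ : (0:ℝ) ≤ 2 * σ * a₀ := by nlinarith
  have h2τ : (0:ℝ) ≤ 2 * τ * h₀ := by nlinarith
  have hwB : |w| ≤ G * Δ := by
    rw [hG]
    calc |w| ≤ |2 * σ * a₀ * (a - a₀)| + |2 * τ * h₀ * (h - h₀)| := abs_add_le _ _
      _ = 2 * σ * a₀ * |a - a₀| + 2 * τ * h₀ * |h - h₀| := by
          rw [abs_mul, abs_mul (2 * τ * h₀), abs_of_nonneg h2σ, abs_of_nonneg h2τ]
      _ ≤ 2 * σ * a₀ * Δ + 2 * τ * h₀ * Δ := add_le_add (mul_le_mul_of_nonneg_left ha h2σ)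
          (mul_le_mul_of_nonneg_left hh h2τ)
      _ = (2 * σ * a₀ + 2 * τ * h₀) * Δ := by ring
  -- s ∈ [lo, hi]
  have hs_lo : lo ≤ s := by
    have h1 : (a₀ - Δ) ^ 2 ≤ a ^ 2 := pow_le_pow_left₀ (by linarith) (by linarith) 2
    have h2 : (h₀ - Δ) ^ 2 ≤ h ^ 2 := pow_le_pow_left₀ (by linarith) (by linarith) 2
    calc lo ≤ σ * (a₀ - Δ) ^ 2 + τ * (h₀ - Δ) ^ 2 := hlo'
      _ ≤ s := add_le_add (mul_le_mul_of_nonneg_left h1 hσ) (mul_le_mul_of_nonneg_left h2 hτ)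
  have hs_hi : s ≤ hi := by
    have h1 : a ^ 2 ≤ (a₀ + Δ) ^ 2 := pow_le_pow_left₀ ha_nn (by linarith) 2
    have h2 : h ^ 2 ≤ (h₀ + Δ) ^ 2 := pow_le_pow_left₀ hh_nn (by linarith) 2
    calc s ≤ σ * (a₀ + Δ) ^ 2 + τ * (h₀ + Δ) ^ 2 :=
          add_le_add (mul_le_mul_of_nonneg_left h1 hσ) (mul_le_mul_of_nonneg_left h2 hτ)
      _ ≤ hi := hhi'
  have hs_pos : 0 < s := hlo.trans_le hs_lo
  have hm_pos : 0 < m := by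
    have h1 : (a₀ - Δ) ^ 2 ≤ a₀ ^ 2 := pow_le_pow_left₀ (by linarith) (by linarith) 2
    have h2 : (h₀ - Δ) ^ 2 ≤ h₀ ^ 2 := pow_le_pow_left₀ (by linarith) (by linarith) 2
    have : lo ≤ m := by
      rw [hm]
      calc lo ≤ σ * (a₀ - Δ) ^ 2 + τ * (h₀ - Δ) ^ 2 := hlo'
        _ ≤ σ * a₀ ^ 2 + τ * h₀ ^ 2 := add_le_add (mul_le_mul_of_nonneg_left h1 hσ) (mul_le_mul_of_nonneg_left h2 hτ)
    exact hlo.trans_le this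
  have hmn1 : 0 ≤ (n : ℝ) * m⁻¹ ^ (n + 1) := by positivity
  have hT : m⁻¹ ^ n + -(↑n * m⁻¹ ^ (n + 1) * (2 * σ * a₀)) * (a - a₀) + -(↑n * m⁻¹ ^ (n + 1) * (2 * τ * h₀)) * (h - h₀)
      = m⁻¹ ^ n - n * m⁻¹ ^ (n + 1) * w := by rw [hw]; ring
  show |(σ * a ^ 2 + τ * h ^ 2)⁻¹ ^ n - _| ≤ ρ
  rw [← hs, hT, abs_le]
  have hsplit : (n : ℝ) * m⁻¹ ^ (n + 1) * (s - m) = n * m⁻¹ ^ (n + 1) * w + n * m⁻¹ ^ (n + 1) * e := by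
    rw [hsdec]; ring
  constructor
  · -- lower: tangent
    have ht := inv_pow_tangent_le n hm_pos hs_pos
    have h3 : (n : ℝ) * m⁻¹ ^ (n + 1) * e ≤ ρ :=
      (mul_le_mul_of_nonneg_left heε hmn1).trans hρ₁
    rw [hsplit] at ht
    linarith [ht, h3]
  · -- upper: chord
    have hc := inv_pow_le_chord n hlo hlh hs_lo hs_hi
    have hpow : hi⁻¹ ^ n ≤ lo⁻¹ ^ n :=
      pow_le_pow_left₀ (inv_nonneg.2 (hlo.trans hlh).le) ((inv_le_inv₀ (hlo.trans hlh) hlo).2 hlh.le) n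
    have hκ0 : κ ≤ 0 := by
      rw [hκ]; exact div_nonpos_of_nonpos_of_nonneg (sub_nonpos.2 hpow) (sub_pos.2 hlh).le
    have hchord : lo⁻¹ ^ n + (hi⁻¹ ^ n - lo⁻¹ ^ n) / (hi - lo) * (s - lo)
        = (m⁻¹ ^ n - n * m⁻¹ ^ (n + 1) * w) + (D₀ + D₁ * w) + κ * e := by
      rw [hD₀, hD₁, hκ, hsdec]; ring
    have hκe : κ * e ≤ 0 := mul_nonpos_of_nonpos_of_nonneg hκ0 he0
    have hDw : D₀ + D₁ * w ≤ ρ := (affine_le_of_abs_le hwB).trans hρ₂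
    rw [hchord] at hc
    linarith [hc, hκe, hDw]

/-- Two-sided bounds at a point of the box. [folklore] -/
theorem bounds {f : ℝ → ℝ → ℝ} {c₀ c₁ c₂ ρ : ℝ} (hf : AffEncl a₀ h₀ Δ f c₀ c₁ c₂ ρ) {a h : ℝ}
    (ha : |a - a₀| ≤ Δ) (hh : |h - h₀| ≤ Δ) :
    c₀ + c₁ * (a - a₀) + c₂ * (h - h₀) - ρ ≤ f a h ∧ f a h ≤ c₀ + c₁ * (a - a₀) + c₂ * (h - h₀) + ρ := by
  have h1 := abs_le.1 (hf a h ha hh)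
  constructor <;> linarith [h1.1, h1.2]

/-- **Enclosed coefficients times fixed values**: if every coefficient function `t k` is affinely enclosed, then at every
point of the box `Σ_k t_k(a,h)·q_k ≥ Σ_k (c₀ + c₁(a−a₀) + c₂(h−h₀))_k·q_k − Σ_k ρ_k·|q_k|` — the form in which a
parametrised quadratic form `Σ_k t_k(a,h)·P_k(v)` is bounded below by an affine-in-`(a,h)` family minus a fixed majorant.
[folklore] -/
theorem sum_mul_ge {ι : Type*} (S : Finset ι) {t : ι → ℝ → ℝ → ℝ} {c₀ c₁ c₂ ρ : ι → ℝ}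
    (ht : ∀ k ∈ S, AffEncl a₀ h₀ Δ (t k) (c₀ k) (c₁ k) (c₂ k) (ρ k)) (q : ι → ℝ) {a h : ℝ}
    (ha : |a - a₀| ≤ Δ) (hh : |h - h₀| ≤ Δ) :
    (∑ k ∈ S, (c₀ k + c₁ k * (a - a₀) + c₂ k * (h - h₀)) * q k) - ∑ k ∈ S, ρ k * |q k| ≤
      ∑ k ∈ S, t k a h * q k := by
  rw [sub_le_iff_le_add, ← Finset.sum_add_distrib]
  apply Finset.sum_le_sum
  intro k hk
  have hkey : (c₀ k + c₁ k * (a - a₀) + c₂ k * (h - h₀) - t k a h) * q k ≤ ρ k * |q k| := by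
    calc (c₀ k + c₁ k * (a - a₀) + c₂ k * (h - h₀) - t k a h) * q k
        ≤ |(c₀ k + c₁ k * (a - a₀) + c₂ k * (h - h₀) - t k a h) * q k| := le_abs_self _
      _ = |c₀ k + c₁ k * (a - a₀) + c₂ k * (h - h₀) - t k a h| * |q k| := abs_mul _ _
      _ ≤ ρ k * |q k| := by
          apply mul_le_mul_of_nonneg_right _ (abs_nonneg _)
          rw [abs_sub_comm]; exact ht k hk a h ha hh
  linarith

/-- **Four corners**: an affine function of `(a − a₀, h − h₀)` that is nonnegative at the four corners of the box is
nonnegative on the box (used with `α, β, γ` = values of fixed quadratic forms at a displacement field). [folklore] -/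
theorem corners_nonneg {α β γ : ℝ} (hpp : 0 ≤ α + β * Δ + γ * Δ) (hpm : 0 ≤ α + β * Δ - γ * Δ)
    (hmp : 0 ≤ α - β * Δ + γ * Δ) (hmm : 0 ≤ α - β * Δ - γ * Δ) {a h : ℝ}
    (ha : |a - a₀| ≤ Δ) (hh : |h - h₀| ≤ Δ) : 0 ≤ α + β * (a - a₀) + γ * (h - h₀) := by
  have hb : -(|β| * Δ) ≤ β * (a - a₀) := by
    have : |β * (a - a₀)| ≤ |β| * Δ := by rw [abs_mul]; exact mul_le_mul_of_nonneg_left ha (abs_nonneg _)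
    linarith [neg_abs_le (β * (a - a₀))]
  have hc : -(|γ| * Δ) ≤ γ * (h - h₀) := by
    have : |γ * (h - h₀)| ≤ |γ| * Δ := by rw [abs_mul]; exact mul_le_mul_of_nonneg_left hh (abs_nonneg _)
    linarith [neg_abs_le (γ * (h - h₀))]
  have hmin : 0 ≤ α - |β| * Δ - |γ| * Δ := by
    rcases le_or_gt 0 β with hβ | hβ <;> rcases le_or_gt 0 γ with hγ | hγ
    · rw [abs_of_nonneg hβ, abs_of_nonneg hγ]; linarith
    · rw [abs_of_nonneg hβ, abs_of_neg hγ]; linarith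
    · rw [abs_of_neg hβ, abs_of_nonneg hγ]; linarith
    · rw [abs_of_neg hβ, abs_of_neg hγ]; linarith
  linarith

/-- Instantiation check (first hcp shell, in-plane bonds: `σ = 1, τ = 0`, `n = 8`, the certified box): every side
condition is a decidable rational inequality (`norm_num`); the resulting radius `ρ = 2.5·10⁻⁶` is second order in the box
width, against a zero-order variation `13.5 × 1.9·10⁻⁴ ≈ 2.6·10⁻³` of `s⁻⁸` itself. [folklore] -/
example : AffEncl (97129 / 100000 : ℝ) (39647 / 50000) (1 / 10000) (fun a h => (1 * a ^ 2 + 0 * h ^ 2)⁻¹ ^ 8)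
    (((97129 / 100000 : ℝ) ^ 2)⁻¹ ^ 8) (-(8 * ((97129 / 100000 : ℝ) ^ 2)⁻¹ ^ 9 * (2 * 1 * (97129 / 100000))))
    (-(8 * ((97129 / 100000 : ℝ) ^ 2)⁻¹ ^ 9 * (2 * 0 * (39647 / 50000)))) (25 / 10000000) := by
  have h := invPow_sqLen (a₀ := (97129 / 100000 : ℝ)) (h₀ := 39647 / 50000) (Δ := 1 / 10000) 8
    (σ := 1) (τ := 0) (lo := (97119 / 100000) ^ 2) (hi := (97139 / 100000) ^ 2) (ρ := 25 / 10000000)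
    (m := (97129 / 100000) ^ 2)
    (κ := ((((97139 : ℝ) / 100000) ^ 2)⁻¹ ^ 8 - (((97119 : ℝ) / 100000) ^ 2)⁻¹ ^ 8) / ((97139 / 100000) ^ 2 - (97119 / 100000) ^ 2))
    (G := 2 * 1 * (97129 / 100000) + 2 * 0 * (39647 / 50000))
    (D₀ := (((97119 : ℝ) / 100000) ^ 2)⁻¹ ^ 8 +
      ((((97139 : ℝ) / 100000) ^ 2)⁻¹ ^ 8 - (((97119 : ℝ) / 100000) ^ 2)⁻¹ ^ 8) / ((97139 / 100000) ^ 2 - (97119 / 100000) ^ 2) *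
        ((97129 / 100000) ^ 2 - (97119 / 100000) ^ 2) - (((97129 : ℝ) / 100000) ^ 2)⁻¹ ^ 8)
    (D₁ := ((((97139 : ℝ) / 100000) ^ 2)⁻¹ ^ 8 - (((97119 : ℝ) / 100000) ^ 2)⁻¹ ^ 8) / ((97139 / 100000) ^ 2 - (97119 / 100000) ^ 2) +
      8 * (((97129 : ℝ) / 100000) ^ 2)⁻¹ ^ (8 + 1))
    (by norm_num) (by norm_num) (by norm_num) (by norm_num) (by norm_num) (by norm_num) (by norm_num) (by norm_num)
    (by norm_num) rfl rfl rfl rfl (by norm_num) (by norm_num)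
  simpa using h

end AffEncl

end Summit.AtomisticToContinuum.Crystallization.Theorems.StrictSplittingRuleTorusLMI
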